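import Literature.Barriers.CriticalPhenomena.TimarLemma42QuasiTransitive
import Literature.Barriers.CriticalPhenomena.TimarLemma42Uniform
import HarnessLib

/-!
# Timár 2006, Lemma 4.2 uniform over all deep height windows, on quasi-transitive graphs
# ("there is also a uniform choice", proof of Thm. 4.3) — PROVED

Barrier catalogue `Literature/Barriers/CriticalPhenomena/`; the quasi-transitive twin of
`TimarLemma42Uniform.lean` (TRANSITIVE graphs, weights `autWeight G o`, `Δ = minNbrWeight G o`),
for the heights `h = η.height` of a height system `η : HeightSystem G o`
(`TimarHeightsQuasiTransitive.lean`) and `Δ = η.ratio`. Á. Timár, *Percolation on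
nonunimodular transitive graphs*, Ann. Probab. 34 (2006) 2344–2364, Lemma 4.2 and proof of
Thm. 4.3, p. 2355 ("Clearly, there is also a uniform choice, so that `B_x(i; r)` is good for any
`x` below `o`").

PROVED (`HeightSystem.exists_forall_measure_windowFewEvent_le`): on a connected, locally finite,
nonunimodular graph of bounded degree carrying a height system, under Bernoulli(`p`) bond
percolation with `p < 1`, for every `k` and every `ε > 0` there is a threshold `A₀ > 0` such
that for EVERY `A ∈ (0, A₀]`

  `P[ C(o) infinite and light, and the open cluster of o inside {h > A} has fewer than k`
  `    vertices in the window (A, A Δ⁻¹] ] ≤ ε`.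

The proof is the diagonal argument of `TimarLemma42Uniform.lean` verbatim (bad thresholds
`a_0 ≤ Δ²`, `a_{n+1} ≤ Δ² a_n` interleaved into one threshold sequence `diagThreshold Δ a` —
reused from that file — whose odd slabs are the bad windows, to which Lemma 4.2,
`HeightSystem.tsum_slabFewEvent_ne_top`, applies).

## References

* Á. Timár, Ann. Probab. 34 (2006) 2344–2364 (arXiv:math/0702875): Lemma 4.2 (statement for
  general separating sequences `(L_i)`), p. 2353 (dense levels), proof of Thm. 4.3, p. 2355.
  [Timar2006]
* T. Hutchcroft, C. R. Math. Acad. Sci. Paris 354 (2016) 944–947, §2 (quasi-transitive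
  setting). [Hutchcroft2016]
-/

noncomputable section

namespace Literature.Barriers.CriticalPhenomena

open _root_.MeasureTheory _root_.Filter Literature.Probability.Percolation
open scoped _root_.ENNReal _root_.Topology

variable {V : Type*}

namespace HeightSystem

variable {G : SimpleGraph V} {o : V} (η : HeightSystem G o)

/-! ### Regions, windows and the cluster of `o` inside a region, for one threshold `A` -/

/-- The region `{v : A < h(v)}` above the threshold `A`; for `A = t_{j+1}` this is
`η.tregion t j`. [cite: Timar2006, §4 (proof of Lemma 4.2: L_j and the levels above L_j)] -/
def wregion (η : HeightSystem G o) (A : ℝ≥0∞) : Set V :=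
  {v | A < η.height v}

/-- The window `(A, A Δ⁻¹] = {v : A < h(v) ≤ A Δ⁻¹}` of ratio `Δ⁻¹` above the threshold `A`:
one separating set of levels. [cite: Timar2006, §4 (separating sets of levels; proof of Thm. 4.3)] -/
def wwindow (η : HeightSystem G o) (A : ℝ≥0∞) : Set V :=
  {v | A < η.height v ∧ η.height v ≤ A * η.ratio⁻¹}

/-- The open cluster of `o` inside the region `{h > A}`: the `C_j` of the proof of Lemma 4.2.
[cite: Timar2006, §4 (proof of Lemma 4.2: C_j)] -/
def wregionCluster (η : HeightSystem G o) (A : ℝ≥0∞) (ω : BondConfig V) : Set V :=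
  openClusterIn (withinGraph G (η.wregion A)) ω o

/-- The **bad event at threshold `A`**: `C(o)` is infinite and light, and the cluster of `o`
inside `{h > A}` has fewer than `k` vertices in the window `(A, A Δ⁻¹]`.
[cite: Timar2006, §4 (Lemma 4.2; proof of Thm. 4.3, first property of being good)] -/
def windowFewEvent (η : HeightSystem G o) (A : ℝ≥0∞) (k : ℕ) : Set (BondConfig V) :=
  {ω | (openCluster ω o).Infinite ∧ ¬ IsHeavy G o (openCluster ω o) ∧
    (η.wregionCluster A ω ∩ η.wwindow A).encard < k}

/-- The region cluster lies in the open cluster of `o`. [folklore] -/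
theorem wregionCluster_subset_openCluster (A : ℝ≥0∞) (ω : BondConfig V) :
    η.wregionCluster A ω ⊆ openCluster ω o :=
  openClusterIn_subset_openCluster _ ω o

/-! ### The interleaved threshold sequence (`diagThreshold`, reused) for `Δ = η.ratio` -/

/-- The separating condition `t_{j+1} ≤ Δ t_j` for the interleaved sequence, given
`a_{n+1} ≤ Δ² a_n`. [folklore] -/
theorem diagThreshold_succ_le {a : ℕ → ℝ≥0∞} (ha : ∀ n, a (n + 1) ≤ η.ratio ^ 2 * a n) (j : ℕ) :
    diagThreshold η.ratio a (j + 1) ≤ η.ratio * diagThreshold η.ratio a j := by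
  set Δ := η.ratio with hΔ
  have hcancel : Δ * Δ⁻¹ = 1 := ENNReal.mul_inv_cancel η.ratio_ne_zero η.ratio_ne_top
  obtain ⟨n, rfl | rfl⟩ := Nat.even_or_odd' j
  · cases n with
    | zero =>
      show diagThreshold Δ a (0 + 1) ≤ Δ * diagThreshold Δ a 0
      rw [zero_add, diagThreshold_one, diagThreshold]
      calc a 0 * Δ⁻¹ = Δ * Δ⁻¹ * (a 0 * Δ⁻¹) := by rw [hcancel, one_mul]
        _ = Δ * (a 0 * Δ⁻¹ * Δ⁻¹) := by ring
        _ ≤ Δ * (a 0 * Δ⁻¹ * Δ⁻¹) := le_rfl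
    | succ m =>
      have hj : 2 * (m + 1) = 2 * m + 1 + 1 := by ring
      rw [hj, diagThreshold_even, show 2 * m + 1 + 1 + 1 = 2 * (m + 1) + 1 by ring,
        diagThreshold_odd]
      calc a (m + 1) * Δ⁻¹ ≤ Δ ^ 2 * a m * Δ⁻¹ := by gcongr; exact ha m
        _ = Δ * a m * (Δ * Δ⁻¹) := by ring
        _ = Δ * a m := by rw [hcancel, mul_one]
  · rw [diagThreshold_even, diagThreshold_odd]
    calc a n = a n * (Δ * Δ⁻¹) := by rw [hcancel, mul_one]
      _ = Δ * (a n * Δ⁻¹) := by ring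
      _ ≤ Δ * (a n * Δ⁻¹) := le_rfl

/-- The interleaved thresholds are nonzero when the `a_n` are. [folklore] -/
theorem diagThreshold_ne_zero {a : ℕ → ℝ≥0∞} (ha : ∀ n, a n ≠ 0) (j : ℕ) :
    diagThreshold η.ratio a j ≠ 0 := by
  have hinv : η.ratio⁻¹ ≠ 0 := ENNReal.inv_ne_zero.2 η.ratio_ne_top
  cases j with
  | zero => exact mul_ne_zero (mul_ne_zero (ha 0) hinv) hinv
  | succ j =>
    rw [diagThreshold]
    refine mul_ne_zero (ha _) ?_
    split_ifs
    · exact hinv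
    · exact one_ne_zero

/-- `t_1 < 1` as soon as `a_0 ≤ Δ²`. [folklore] -/
theorem diagThreshold_one_lt_one {a : ℕ → ℝ≥0∞} (ha0 : a 0 ≤ η.ratio ^ 2) :
    diagThreshold η.ratio a 1 < 1 := by
  rw [diagThreshold_one]
  calc a 0 * η.ratio⁻¹ ≤ η.ratio ^ 2 * η.ratio⁻¹ := by gcongr
    _ = η.ratio * (η.ratio * η.ratio⁻¹) := by ring
    _ = η.ratio := by rw [ENNReal.mul_inv_cancel η.ratio_ne_zero η.ratio_ne_top, mul_one]
    _ < 1 := η.ratio_lt_one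

/-- The region above slab `2n+1` of the interleaved sequence is `{h > a_n}`. [folklore] -/
theorem tregion_diagThreshold_odd (a : ℕ → ℝ≥0∞) (n : ℕ) :
    η.tregion (diagThreshold η.ratio a) (2 * n + 1) = η.wregion (a n) := by
  ext v
  simp only [tregion, wregion, Set.mem_setOf_eq, diagThreshold_even]

/-- Slab `2n+1` of the interleaved sequence is the window `(a_n, a_n Δ⁻¹]`. [folklore] -/
theorem tslab_diagThreshold_odd (a : ℕ → ℝ≥0∞) (n : ℕ) :
    η.tslab (diagThreshold η.ratio a) (2 * n + 1) = η.wwindow (a n) := by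
  ext v
  simp only [tslab, wwindow, Set.mem_setOf_eq, diagThreshold_even, diagThreshold_odd]

/-- Hence the region cluster `C_{2n+1}` of the interleaved sequence is the cluster of `o` inside
`{h > a_n}`. [folklore] -/
theorem regionCluster_diagThreshold_odd (a : ℕ → ℝ≥0∞) (n : ℕ) (ω : BondConfig V) :
    η.regionCluster (diagThreshold η.ratio a) (2 * n + 1) ω = η.wregionCluster (a n) ω := by
  rw [regionCluster, tregion_diagThreshold_odd, wregionCluster]

/-- **The bad event at threshold `a_n` is contained in the event `A_{2n+1}` of the proof of
Lemma 4.2** for the interleaved sequence (for configurations on `E(G)`).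
[cite: Timar2006, §4 (proof of Lemma 4.2, first sentence: "By lightness, |C(o) ∩ L_i| ≥ 1")] -/
theorem windowFewEvent_subset_slabFewEvent [G.LocallyFinite] (hconn : G.Connected)
    {a : ℕ → ℝ≥0∞} (ha : ∀ n, a (n + 1) ≤ η.ratio ^ 2 * a n) (ha0 : a 0 ≤ η.ratio ^ 2)
    (hane : ∀ n, a n ≠ 0) (k n : ℕ) {ω : BondConfig V} (hω : ω ⊆ G.edgeSet)
    (hbad : ω ∈ η.windowFewEvent (a n) k) :
    ω ∈ η.slabFewEvent (diagThreshold η.ratio a) k (2 * n + 1) := by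
  obtain ⟨hinf, hlight, hfew⟩ := hbad
  have hsep := η.diagThreshold_succ_le ha
  have ht0 : ∀ j, diagThreshold η.ratio a j ≠ 0 := η.diagThreshold_ne_zero hane
  have ht1 := η.diagThreshold_one_lt_one ha0
  refine ⟨?_, ?_⟩
  · rw [Set.one_le_encard_iff_nonempty]
    exact η.regionCluster_inter_tslab_nonempty hsep (η.mem_tregion_self hconn hsep ht1 _) hω
      (η.not_subset_tregion_of_light ht0 hinf hlight)
  · rwa [regionCluster_diagThreshold_odd, tslab_diagThreshold_odd]

/-! ### The uniform Lemma 4.2 -/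

/-- **Timár 2006, Lemma 4.2 in the form uniform over all deep windows, PROVED on graphs with a
height system** (the "uniform choice" of the proof of Thm. 4.3, p. 2355): on a connected,
locally finite graph of bounded degree with a height system `η`, under
Bernoulli(`p`) bond percolation with `p < 1`: for every `k` and every `ε > 0` there is `A₀ > 0`
such that for every threshold `0 < A ≤ A₀`, the probability that `C(o)` is infinite and light
while the cluster of `o` inside `{h > A}` has fewer than `k` vertices in the window
`(A, A Δ⁻¹]` is at most `ε`.
[cite: Timar2006, Lemma 4.2 and proof of Thm. 4.3 (p. 2355, "Clearly, there is also a uniform choice")] -/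
theorem exists_forall_measure_windowFewEvent_le [G.LocallyFinite] [Countable V]
    (hconn : G.Connected) {D : ℕ} (hD : ∀ v, G.degree v ≤ D)
    {p : unitInterval} (hp : (p : ℝ) < 1) (k : ℕ) {ε : ℝ≥0∞} (hε : 0 < ε) :
    ∃ A₀ : ℝ≥0∞, 0 < A₀ ∧ ∀ A : ℝ≥0∞, 0 < A → A ≤ A₀ →
      bondPercolation G p (η.windowFewEvent A k) ≤ ε := by
  set Δ := η.ratio with hΔ
  have hΔ0 : Δ ≠ 0 := η.ratio_ne_zero
  have hΔ2 : 0 < Δ ^ 2 := pos_iff_ne_zero.2 (pow_ne_zero _ hΔ0)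
  by_contra H
  push Not at H
  -- `H : ∀ A₀, 0 < A₀ → ∃ A, 0 < A ∧ A ≤ A₀ ∧ ε < P[bad A]`; a total choice function
  choose f hf0 hfle hfε using H
  let g : ℝ≥0∞ → ℝ≥0∞ := fun A₀ => if h : 0 < A₀ then f A₀ h else 1
  have hg : ∀ {A₀ : ℝ≥0∞}, 0 < A₀ → 0 < g A₀ ∧ g A₀ ≤ A₀ ∧
      ε < bondPercolation G p (η.windowFewEvent (g A₀) k) := by
    intro A₀ h
    simp only [g, dif_pos h]
    exact ⟨hf0 A₀ h, hfle A₀ h, hfε A₀ h⟩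
  -- the bad thresholds `a_0 ≤ Δ²`, `a_{n+1} ≤ Δ² a_n`
  let a : ℕ → ℝ≥0∞ := fun n => Nat.rec (g (Δ ^ 2)) (fun _ b => g (Δ ^ 2 * b)) n
  have ha_zero : a 0 = g (Δ ^ 2) := rfl
  have ha_succ : ∀ n, a (n + 1) = g (Δ ^ 2 * a n) := fun n => rfl
  have hapos : ∀ n, 0 < a n := by
    intro n
    induction n with
    | zero => rw [ha_zero]; exact (hg hΔ2).1
    | succ m ih => rw [ha_succ]; exact (hg (ENNReal.mul_pos hΔ2.ne' ih.ne')).1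
  have hane : ∀ n, a n ≠ 0 := fun n => (hapos n).ne'
  have ha0 : a 0 ≤ Δ ^ 2 := by rw [ha_zero]; exact (hg hΔ2).2.1
  have ha : ∀ n, a (n + 1) ≤ Δ ^ 2 * a n := fun n => by
    rw [ha_succ]; exact (hg (ENNReal.mul_pos hΔ2.ne' (hane n))).2.1
  have haε : ∀ n, ε < bondPercolation G p (η.windowFewEvent (a n) k) := by
    intro n
    cases n with
    | zero => rw [ha_zero]; exact (hg hΔ2).2.2
    | succ m => rw [ha_succ]; exact (hg (ENNReal.mul_pos hΔ2.ne' (hane m))).2.2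
  -- the interleaved threshold sequence and Lemma 4.2 for it
  set t := diagThreshold Δ a with ht
  have hsep : ∀ j, t (j + 1) ≤ η.ratio * t j := η.diagThreshold_succ_le ha
  have ht1 : t 1 < 1 := η.diagThreshold_one_lt_one ha0
  have hsum := η.tsum_slabFewEvent_ne_top hconn hD hsep ht1 hp k
  have htend := ENNReal.tendsto_atTop_zero_of_tsum_ne_top hsum
  -- along the odd indices the events `A_{2n+1}` contain the bad events
  have hodd : Tendsto (fun n : ℕ => 2 * n + 1) atTop atTop :=
    tendsto_atTop_atTop.2 fun b => ⟨b, fun n hn => by omega⟩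
  have hev := (tendsto_order.1 (htend.comp hodd)).2 ε hε
  obtain ⟨n, hn⟩ := hev.exists
  have hle : bondPercolation G p (η.windowFewEvent (a n) k) ≤
      bondPercolation G p (η.slabFewEvent t k (2 * n + 1)) := by
    refine measure_mono_ae ?_
    have hωE : ∀ᵐ ω ∂(bondPercolation G p), ω ⊆ G.edgeSet :=
      ProbabilityTheory.setBernoulli_ae_subset
    filter_upwards [hωE] with ω hω hbad
    exact η.windowFewEvent_subset_slabFewEvent hconn ha ha0 hane k n hω hbad
  exact absurd (lt_of_lt_of_le (haε n) hle) (not_lt.2 (le_of_lt hn))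

end HeightSystem

end Literature.Barriers.CriticalPhenomena

end
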